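import Summits.AnomalousDissipation.AnomalousDissipation.Theorems.MomentParityResolvedDissipationReduction

/-!
# Stub `stub_weightedH2` of the line `Sketch`
# (crux stmt-AnomalousDissipation-14330, `MomentParity.UniformResolution`)

Supports stmt-AnomalousDissipation-14330 (helper of the line lead; nothing here closes an item).

**The Foias–Guillopé–Temam weighted `H²` bound, exponent `4`, uniformly over a family of cylindrically
Galerkin-stationary level laws in balls.** Let `f` be smooth and `ν > 0`. If every law `μ` of a family `𝓕`
of measures on `H = L²_σ(T³)` is a probability law carried by level-`N` fields (`IsLevel N u`) in some ball
`‖u‖ ≤ R` — level `N` and radius `R` depending on `μ` — and annihilates the tested Galerkin–Navier–Stokes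
generator `⟨F(u), Φ'(u)⟩` of every compactly supported `C¹` cylindrical test functional `Φ` with level-`N`
band fields (FMRT's stationarity), then `∫ |Au|²/(1+‖∇u‖²)⁴ dμ ≤ C` with ONE `C = C(f, ν) < ∞` for all
`μ ∈ 𝓕` (`WeightedH2Bound 4 𝓕`, `Theorems/UniformResolution/Negative/ResolutionCriterion.lean`).

Proof (a composition of landed lemmas of the sibling crux `MomentParity.ResolvedDissipation`).
* `fgtRow_of_cylStationary`: the FGT row `u ↦ (1+Z_N u)⁻⁴ ⟨F(u), A P_N u⟩`,
  `Z_N u = 4π² Σ_{|k|≤N} |k|²‖û k‖²`, of such a law is integrable with zero mean — the cylindrical test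
  functional of `CylRow.exists_cylindricalTest` for the profile `Ψ(e,z) = -(1+z)⁻³/6` (`C¹` on
  `ℝ × (-1,∞) ⊇ [0,∞)²`, `fgtProfile_contDiffOn`) has differential
  `2∂₁Ψ P_N u + 2∂₂Ψ A P_N u = (1+Z_N u)⁻⁴ A P_N u` on the carrier (`fderiv_fgtProfile`), and
  `⟨F(u), ·⟩` is linear (`CylRow.nsGeneratorPairing_add_smul`); transfer along the a.e. equality.
* `stub_weightedH2`: `FGT.stub_fgtBound` supplies `C(f, ν)` BEFORE `N` and `R` are chosen, so the bound
  is uniform over `𝓕` although level and radius vary with `μ`.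
Reference: Foias–Manley–Rosa–Temam, *Navier–Stokes Equations and Turbulence* (2001), Ch. IV §1.2 and
Prop. 3.3; Foias–Guillopé–Temam 1981.
-/

noncomputable section

-- `Summit.<Summit>.<Problem>` duplicate namespace is the tree's mandated layout for single-conjunct summits.
set_option linter.dupNamespace false

namespace Summit.AnomalousDissipation.AnomalousDissipation.Theorems.MomentParityUniformResolution

open MeasureTheory Filter Topology
open scoped ENNReal
open Literature.Analysis.FunctionSpaces Literature.Analysis.FluidPDE
open Summit.AnomalousDissipation.AnomalousDissipation.Theorems.CubicParityLoud.Negative (T3 R3 H3 L2T3)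
open Summit.AnomalousDissipation.AnomalousDissipation.Theorems.QuarticGate.Negative
open Summit.AnomalousDissipation.AnomalousDissipation.Theorems.UniformResolution.Negative

/-- **The FGT row of a cylindrically Galerkin-stationary level law vanishes.** If a law `μ` on `H` is
carried by level-`N` fields in the ball `‖u‖ ≤ R` and annihilates the generator row of every compactly
supported `C¹` cylindrical test functional with level-`N` band fields (each such row being integrable), then
its Foias–Guillopé–Temam row `u ↦ (1+Z_N u)⁻⁴ ⟨F(u), A P_N u⟩` is integrable with zero mean: instance
`Ψ(e,z) = -(1+z)⁻³/6` of `CylRow.exists_cylindricalTest` on `U = ℝ × (-1, ∞)`, identified on the carrier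
by `fderiv_fgtProfile` (`∂₁Ψ = 0`, `∂₂Ψ = ½(1+z)⁻⁴`) and linearity of `⟨F(u), ·⟩`. [folklore] -/
theorem fgtRow_of_cylStationary {ν : ℝ} {f : T3 → R3} (hf : Torus.IsSmooth f) {N : ℕ} {R : ℝ}
    {μ : Measure H3} (hL : ∀ᵐ u ∂μ, IsLevel N u) (hB : ∀ᵐ u ∂μ, ‖u‖ ≤ R)
    (hcyl : ∀ Φ : Torus.CylindricalTest (Fin 3), (∀ i, IsBandTest N (Φ.g i)) →
      Integrable (fun u => Torus.nsGeneratorPairing ν f u (Φ.grad u)) μ ∧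
        ∫ u, Torus.nsGeneratorPairing ν f u (Φ.grad u) ∂μ = 0) :
    Integrable (fun u : H3 =>
        ((1 + 4 * Real.pi ^ 2 * ∑ k ∈ Torus.freqBall N, Torus.freqNormSq k *
            ‖UnitAddTorus.mFourierCoeff (EuclideanSpace.complexify ∘ (u.1 : T3 → R3)) k‖ ^ 2) ^ 4)⁻¹ *
          Torus.nsGeneratorPairing ν f u (Torus.realTrigPoly (Torus.freqBall N) fun k =>
            (((4 * Real.pi ^ 2 * Torus.freqNormSq k : ℝ)) : ℂ) •
              UnitAddTorus.mFourierCoeff (EuclideanSpace.complexify ∘ (u.1 : T3 → R3)) k)) μ ∧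
      ∫ u, ((1 + 4 * Real.pi ^ 2 * ∑ k ∈ Torus.freqBall N, Torus.freqNormSq k *
            ‖UnitAddTorus.mFourierCoeff (EuclideanSpace.complexify ∘ (u.1 : T3 → R3)) k‖ ^ 2) ^ 4)⁻¹ *
          Torus.nsGeneratorPairing ν f u (Torus.realTrigPoly (Torus.freqBall N) fun k =>
            (((4 * Real.pi ^ 2 * Torus.freqNormSq k : ℝ)) : ℂ) •
              UnitAddTorus.mFourierCoeff (EuclideanSpace.complexify ∘ (u.1 : T3 → R3)) k) ∂μ = 0 := by
  -- the profile domain `U = ℝ × (-1, ∞)` is open and contains the quadrant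
  have hU : IsOpen ((Set.univ : Set ℝ) ×ˢ Set.Ioi (-1 : ℝ)) := isOpen_univ.prod isOpen_Ioi
  have hsub : Set.Ici (0 : ℝ) ×ˢ Set.Ici (0 : ℝ) ⊆ (Set.univ : Set ℝ) ×ˢ Set.Ioi (-1 : ℝ) := by
    rintro ⟨a, b⟩ ⟨-, hb⟩
    refine ⟨Set.mem_univ _, ?_⟩
    simp only [Set.mem_Ici] at hb
    simp only [Set.mem_Ioi]
    linarith
  -- the cylindrical test functional of the row and its (integrable, mean-zero) generator row
  obtain ⟨Φ, hband, hgrad⟩ := MomentParityResolvedDissipation.CylRow.exists_cylindricalTest N R hU hsub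
    MomentParityResolvedDissipation.fgtProfile_contDiffOn
  obtain ⟨hI, h0⟩ := hcyl Φ hband
  -- the band enstrophy is nonnegative, so the profile is differentiated inside `U`
  have hnn : ∀ u : H3, (0 : ℝ) ≤ 4 * Real.pi ^ 2 * ∑ k ∈ Torus.freqBall N, Torus.freqNormSq k *
      ‖UnitAddTorus.mFourierCoeff (EuclideanSpace.complexify ∘ (u.1 : T3 → R3)) k‖ ^ 2 := fun u =>
    mul_nonneg (by positivity) (Finset.sum_nonneg fun k _ =>
      mul_nonneg (Torus.freqNormSq_nonneg _) (sq_nonneg _))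
  -- identification of the row on the carrier
  refine MomentParityResolvedDissipation.CylRow.integrable_and_integral_eq_zero_of_ae_eq hI h0 ?_
  filter_upwards [hL, hB] with u hu huR
  rw [hgrad u hu huR, MomentParityResolvedDissipation.CylRow.nsGeneratorPairing_add_smul ν hf.integrable
    u _ _ (Torus.isSmooth_fourierTruncate N _) (Torus.isSmooth_realTrigPoly _ _)]
  obtain ⟨h1, h2⟩ := MomentParityResolvedDissipation.fderiv_fgtProfile (e := ‖u‖ ^ 2)
    (lt_of_lt_of_le (by norm_num : (-1 : ℝ) < 0) (hnn u))
  rw [h1, h2]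
  ring

/-- **S3 `stub_weightedH2`.** For a smooth force and `ν > 0`, every family of probability laws each carried
by level-`N` fields in some ball (level and radius may vary over the family) and Galerkin-stationary at its
level in FMRT's cylindrical sense satisfies the uniform weighted `H²` bound with exponent `4`:
`∫ |Au|²/(1+‖∇u‖²)⁴ dμ ≤ C(f, ν)` for all `μ` in the family (`FGT.stub_fgtBound`, whose constant is chosen
before the level and the radius, fed with the FGT row `fgtRow_of_cylStationary`). [folklore] -/
theorem stub_weightedH2 (f : UnitAddTorus (Fin 3) → EuclideanSpace ℝ (Fin 3)) (hf : Torus.IsSmooth f)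
    (ν : ℝ) (hν : 0 < ν) (𝓕 : Set (Measure (Torus.energySpace (Fin 3))))
    (h𝓕 : ∀ μ ∈ 𝓕, IsProbabilityMeasure μ ∧ ∃ (N : ℕ) (R : ℝ), (∀ᵐ u ∂μ, IsLevel N u) ∧
      (∀ᵐ u ∂μ, ‖u‖ ≤ R) ∧ ∀ Φ : Torus.CylindricalTest (Fin 3), (∀ i, IsBandTest N (Φ.g i)) →
        Integrable (fun u => Torus.nsGeneratorPairing ν f u (Φ.grad u)) μ ∧
          ∫ u, Torus.nsGeneratorPairing ν f u (Φ.grad u) ∂μ = 0) :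
    WeightedH2Bound 4 𝓕 := by
  obtain ⟨C, hC⟩ := MomentParityResolvedDissipation.FGT.stub_fgtBound ν f hν hf
  refine ⟨ENNReal.ofReal C, ENNReal.ofReal_ne_top, fun μ hμ => ?_⟩
  obtain ⟨hP, N, R, hL, hB, hcyl⟩ := h𝓕 μ hμ
  obtain ⟨hI, h0⟩ := fgtRow_of_cylStationary hf hL hB hcyl
  exact hC N R μ hP hL hB hI h0

end Summit.AnomalousDissipation.AnomalousDissipation.Theorems.MomentParityUniformResolution

end
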